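import Literature.AlgebraicGeometry.Resolution.SecantColonAnnihilatorTransfer
import Mathlib.RingTheory.RegularLocalRing.Polynomial
import Mathlib.RingTheory.FiniteType
import Mathlib.AlgebraicGeometry.Morphisms.FiniteType
import HarnessLib

/-!
# Colon-secant systems of parameters over local rings of algebras of finite type

Topic: `Literature/AlgebraicGeometry/Resolution` (the setting of `KawasakiMacaulayfication`:
schemes of finite type over a field; [Kawasaki2000, Thm. 1.1] assumes a dualizing complex exactly
to have `p`-standard systems of parameters at every point, [Kawasaki2000, §2];
[Cesnavicius2021, §3] "CM-quasi-excellent" for the same purpose).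

* `Localization.localRingHom_surjective` — a surjection `g : P ↠ A` induces surjections
  `P_{g⁻¹𝔭} ↠ A_𝔭` of local rings.
* `exists_isColonSecantSequence_localization` — if `A` is a quotient of a **regular** ring `P`
  (Mathlib `IsRegularRing`: Noetherian with regular localizations), then every finite module over a
  local ring `A_𝔭` of `A` has a colon-secant system of parameters
  (`exists_isColonSecantSequence_of_surjective` with the regular local ring `P_{g⁻¹𝔭}`).
* `exists_isColonSecantSequence_of_finiteType` — in particular for every algebra `A` of finite
  type over a field (or any regular ring) `k` (a quotient of the regular ring `k[x₁,…,xₙ]`,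
  Mathlib `MvPolynomial.isRegularRing_of_isRegularRing`).
* `exists_isColonSecantSequence_stalk` — hence for every finite module over every stalk
  `𝒪_{X,x}` of a scheme `X` locally of finite type over a field.

[cite: Kawasaki2000, §2; Cesnavicius2021, Def. 3.1 (ii); Schenzel1982, Kor. 2.4.3]
-/

noncomputable section

open IsLocalRing Ideal Module

universe u

namespace Literature.AlgebraicGeometry.Resolution

/-! ## Local rings of quotients are quotients of local rings -/

section LocalRingHom

variable {P A : Type u} [CommRing P] [CommRing A]

/-- A surjection `g : P ↠ A` induces a surjection `P_{g⁻¹(𝔭)} ↠ A_𝔭` on local rings (write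
`a/s = g(p)/g(t)` with `t ∉ g⁻¹(𝔭)`). [folklore] -/
theorem Localization.localRingHom_surjective (g : P →+* A) (hg : Function.Surjective g)
    (𝔭 : Ideal A) [𝔭.IsPrime] :
    Function.Surjective (Localization.localRingHom (𝔭.comap g) 𝔭 g rfl) := by
  intro z
  obtain ⟨⟨a, s⟩, rfl⟩ := IsLocalization.mk'_surjective 𝔭.primeCompl z
  obtain ⟨p, rfl⟩ := hg a
  obtain ⟨t, ht⟩ := hg s
  have ht' : t ∈ (𝔭.comap g).primeCompl := by
    change t ∉ 𝔭.comap g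
    rw [Ideal.mem_comap, ht]
    exact s.2
  refine ⟨IsLocalization.mk' _ p ⟨t, ht'⟩, ?_⟩
  rw [Localization.localRingHom_mk']
  congr 1
  exact Subtype.ext ht

end LocalRingHom

/-! ## Existence over local rings of quotients of regular rings -/

section Regular

variable {P A : Type u} [CommRing P] [IsRegularRing P] [CommRing A]

/-- **Colon-secant systems of parameters over the local rings of a quotient of a regular ring**:
if `g : P ↠ A` with `P` regular (e.g. `P = k[x₁,…,xₙ]`), then every finite module `M` of
dimension `d` over a local ring `A_𝔭` has a colon-secant sequence of length `d`
(`exists_isColonSecantSequence_of_surjective` for the regular local ring `P_{g⁻¹𝔭} ↠ A_𝔭`).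
[cite: Cesnavicius2021, Def. 3.1 (ii); Kawasaki2000, §2] -/
theorem exists_isColonSecantSequence_localization (g : P →+* A) (hg : Function.Surjective g)
    (𝔭 : Ideal A) [𝔭.IsPrime] (Rₚ : Type u) [CommRing Rₚ] [Algebra A Rₚ]
    [IsLocalization.AtPrime Rₚ 𝔭] [IsLocalRing Rₚ] (M : Type u) [AddCommGroup M] [Module Rₚ M]
    [Module.Finite Rₚ M] {d : ℕ} (hd : Module.supportDim Rₚ M = d) :
    ∃ rs : List Rₚ, rs.length = d ∧ IsColonSecantSequence M rs := by
  -- `P_{g⁻¹𝔭} ↠ A_𝔭 ≅ Rₚ`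
  let φ : Localization.AtPrime (𝔭.comap g) →+* Rₚ :=
    (IsLocalization.algEquiv 𝔭.primeCompl (Localization.AtPrime 𝔭) Rₚ).toRingEquiv.toRingHom.comp
      (Localization.localRingHom (𝔭.comap g) 𝔭 g rfl)
  have hφ : Function.Surjective φ :=
    (IsLocalization.algEquiv 𝔭.primeCompl (Localization.AtPrime 𝔭) Rₚ).surjective.comp
      (Localization.localRingHom_surjective g hg 𝔭)
  letI : Algebra (Localization.AtPrime (𝔭.comap g)) Rₚ := φ.toAlgebra
  haveI : IsRegularLocalRing (Localization.AtPrime (𝔭.comap g)) :=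
    IsRegularRing.isRegularLocalRing_localization _
  exact exists_isColonSecantSequence_of_surjective (S := Localization.AtPrime (𝔭.comap g)) hφ M hd

end Regular

/-! ## Algebras of finite type over a field -/

section FiniteType

variable {A : Type u} [CommRing A]

/-- **Colon-secant systems of parameters exist over the local rings of algebras of finite type
over a field** (more generally over a regular ring `k`): for every prime `𝔭` of a finitely
generated `k`-algebra `A`, every local ring `Rₚ ≅ A_𝔭` and every finite `Rₚ`-module `M` of
dimension `d` there is a colon-secant sequence `r₁,…,r_d ∈ 𝔭Rₚ` for `M` — the existence of
CM-secant / `p`-standard systems of parameters at the points of a scheme of finite type over a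
field, which [Kawasaki2000, §2] and [Cesnavicius2021, §3] obtain from a dualizing complex, here
from `k[x₁,…,xₙ] ↠ A` and Theorem A over the regular local rings of affine space.
[cite: Kawasaki2000, §2; Cesnavicius2021, Def. 3.1 (ii)] -/
theorem exists_isColonSecantSequence_of_finiteType (k : Type u) [CommRing k] [IsRegularRing k]
    [Algebra k A] [Algebra.FiniteType k A] (𝔭 : Ideal A) [𝔭.IsPrime] (Rₚ : Type u) [CommRing Rₚ]
    [Algebra A Rₚ] [IsLocalization.AtPrime Rₚ 𝔭] [IsLocalRing Rₚ] (M : Type u) [AddCommGroup M]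
    [Module Rₚ M] [Module.Finite Rₚ M] {d : ℕ} (hd : Module.supportDim Rₚ M = d) :
    ∃ rs : List Rₚ, rs.length = d ∧ IsColonSecantSequence M rs := by
  obtain ⟨n, f, hf⟩ := (Algebra.FiniteType.iff_quotient_mvPolynomial'' (R := k) (S := A)).mp
    inferInstance
  exact exists_isColonSecantSequence_localization (P := MvPolynomial (Fin n) k) f.toRingHom hf 𝔭
    Rₚ M hd

end FiniteType

/-! ## Stalks of schemes locally of finite type over a field -/

section Scheme

open _root_.AlgebraicGeometry CategoryTheory

/-- **Colon-secant systems of parameters exist over the stalks of schemes locally of finite type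
over a field**: for `X → Spec k` locally of finite type, `x ∈ X` and a finite `𝒪_{X,x}`-module `M`
of dimension `d` (e.g. `M = 𝒪_{X,x}`), there is a colon-secant sequence of length `d` for `M` —
the pointwise input of [Kawasaki2000, Thm. 4.1] / [Cesnavicius2021, Thm. 3.13] for the schemes of
`KawasakiMacaulayfication`, without dualizing complexes. [cite: Kawasaki2000, §2;
Cesnavicius2021, Def. 3.1 (ii)] -/
theorem exists_isColonSecantSequence_stalk {k : Type u} [Field k] {X : Scheme.{u}}
    (f : X ⟶ Spec (CommRingCat.of k)) [LocallyOfFiniteType f] (x : X) (M : Type u)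
    [AddCommGroup M] [Module (X.presheaf.stalk x) M] [Module.Finite (X.presheaf.stalk x) M]
    {d : ℕ} (hd : Module.supportDim (X.presheaf.stalk x) M = d) :
    ∃ rs : List (X.presheaf.stalk x), rs.length = d ∧ IsColonSecantSequence M rs := by
  obtain ⟨U, hU, hxU, -⟩ := exists_isAffineOpen_mem_and_subset (X := X) (U := ⊤) (x := x) trivial
  letI := TopCat.Presheaf.algebra_section_stalk X.presheaf (⟨x, hxU⟩ : U)
  haveI := hU.isLocalization_stalk ⟨x, hxU⟩
  -- `Γ(X, U)` is of finite type over the regular ring `Γ(Spec k, ⊤) ≅ k`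
  letI : Algebra Γ(Spec (CommRingCat.of k), ⊤) Γ(X, U) := (f.appLE ⊤ U le_top).hom.toAlgebra
  haveI : Algebra.FiniteType Γ(Spec (CommRingCat.of k), ⊤) Γ(X, U) :=
    HasRingHomProperty.appLE (P := @LocallyOfFiniteType) (f := f) inferInstance
      ⟨⊤, isAffineOpen_top _⟩ ⟨U, hU⟩ le_top
  haveI : IsRegularRing Γ(Spec (CommRingCat.of k), ⊤) :=
    IsRegularRing.of_ringEquiv (Scheme.ΓSpecIso (CommRingCat.of k)).commRingCatIsoToRingEquiv.symm
  exact exists_isColonSecantSequence_of_finiteType Γ(Spec (CommRingCat.of k), ⊤)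
    (hU.primeIdealOf ⟨x, hxU⟩).asIdeal (X.presheaf.stalk x) M hd

end Scheme

end Literature.AlgebraicGeometry.Resolution

end
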